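import Mathlib
import Summits.PneNP.PneNP.Theorems.PstarExpandingExist
import Summits.PneNP.PneNP.Theorems.PstarExpanding74Count
import Summits.PneNP.PneNP.Theorems.PstarOverlapCount

/-!
# Random typed `P⋆` instances at boundary ratio `7/4`, II: most outcomes are good, and few pairs overlap (w23d supply)

FRONTIER range-avoidance ladder (cell `pnp-ideate`, residue w23d of ROUNDS 21–23; restricted-model combinatorics — nothing here
bears on `P` versus `NP`).

The estimate of `PstarExpandingExist` re-run at vertex threshold `23/8` (boundary ratio `7/4`): with slack `3s − v74 s ≥ (s+1)/8`
the union-bound term is `≤ 4^{−s}` once `L ≥ 1944K` and `3L⁸ s ≤ N` (`term74_le`, via `PstarExpandingExist.key_identity`), so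
fewer than HALF of the outcomes of `Outcome N m` (`m ≤ K·N`) are `bad74` at radius `N/(3L⁸)` (`two_mul_card_badSet74_lt`).  With
`PstarOverlapCount.two_mul_card_many_le` (fewer than half have more than `80K²` output pairs sharing two variables) — the SAME
outcome space — some outcome is good on both counts (`exists_good74`).  The supply theorems built on it (alteration by
`PstarSubInstance`, `ExpandingTypedExist` by name, the SA+SDP headline) are in `PstarExpanding74Supply`.  Scope: arity `k = 4`.
-/

set_option linter.dupNamespace false -- `Summit.PneNP.PneNP.…`: summit = sub-problem name (D-0017 single-conjunct layout)

open Finset Literature.Computability.Complexity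
open Summit.PneNP.PneNP.Theorems.PstarExpandingModel
open Summit.PneNP.PneNP.Theorems.PstarExpandingCount (cylJ pairsOf)
open Summit.PneNP.PneNP.Theorems.PstarExpandingExist (choose_le key_identity)
open Summit.PneNP.PneNP.Theorems.PstarExpanding74Count
open Summit.PneNP.PneNP.Theorems.PstarOverlapCount (ovl two_mul_card_many_le)

namespace Summit.PneNP.PneNP.Theorems.PstarExpanding74Exist

variable {N m : ℕ}

/-! ## The term estimate -/

/-- **The term estimate at ratio `7/4`.**  For `1 ≤ s`, `1944K ≤ L`, `3L⁸s ≤ N`, `m ≤ KN`: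
`C(m,s)·C(2N, v74 s)·(v74 s⁴/(4N⁴))^s ≤ 4^{−s}`. -/
theorem term74_le (K L N s m : ℕ) (hs : 1 ≤ s) (hL : 1944 * K ≤ L) (hL1 : 1 ≤ L) (hN : 3 * L ^ 8 * s ≤ N)
    (hm : m ≤ K * N) :
    (m.choose s : ℝ) * ((N + N).choose (v74 s) : ℝ) * (((v74 s : ℕ) : ℝ) ^ 4 / (4 * (N : ℝ) ^ 4)) ^ s ≤
      (1 / 4) ^ s := by
  have hv3' := v74_le s
  have hsl := slack74 hs
  have hv1' := one_le_v74 hs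
  set v := v74 s with hvdef
  set q := 3 * s - v with hqdef
  have hvq : v + q = 3 * s := by omega
  have hq1 : 1 ≤ q := by omega
  have hqs : s ≤ 8 * q := by omega
  have hv1 : 1 ≤ v := hv1'
  have hv3 : v ≤ 3 * s := hv3'
  have hL4 : 1 ≤ L ^ 8 := Nat.one_le_pow _ _ hL1
  have hN1 : 1 ≤ N := by nlinarith
  have hvN : v ≤ N := by nlinarith
  -- real versions
  have hsR : (0 : ℝ) < s := by exact_mod_cast hs
  have hvR : (0 : ℝ) < v := by exact_mod_cast hv1
  have hNR : (0 : ℝ) < N := by exact_mod_cast hN1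
  have hLR : (1 : ℝ) ≤ L := by exact_mod_cast hL1
  have hKR : (0 : ℝ) ≤ K := by positivity
  -- Step 1: the two binomials
  have hA : (m.choose s : ℝ) ≤ (3 * K * N / s) ^ s := by
    refine (choose_le m s hs).trans (pow_le_pow_left₀ (by positivity) ?_ _)
    have : (m : ℝ) ≤ K * N := by exact_mod_cast hm
    rw [div_le_div_iff_of_pos_right hsR]
    linarith
  have hB : ((N + N).choose v : ℝ) ≤ (6 * N / v) ^ v := by
    refine (choose_le (N + N) v hv1).trans (le_of_eq ?_)
    push_cast; ring
  -- Step 2: combine and rewrite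
  have hE : (m.choose s : ℝ) * ((N + N).choose v : ℝ) * ((v : ℝ) ^ 4 / (4 * (N : ℝ) ^ 4)) ^ s ≤
      (3 * K * N / s) ^ s * (6 * N / v) ^ v * ((v : ℝ) ^ 4 / (4 * (N : ℝ) ^ 4)) ^ s := by
    have h0 : (0 : ℝ) ≤ ((v : ℝ) ^ 4 / (4 * (N : ℝ) ^ 4)) ^ s := by positivity
    exact mul_le_mul_of_nonneg_right (mul_le_mul hA hB (by positivity) (by positivity)) h0
  rw [key_identity K N v s hsR.ne' hvR.ne' hNR.ne' s v q (by omega)] at hE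
  refine hE.trans ?_
  -- Step 3: bound the three factors
  have f1 : (3 * K * v / (4 * s) : ℝ) ^ s ≤ (9 * K / 4) ^ s := by
    refine pow_le_pow_left₀ (by positivity) ?_ _
    rw [div_le_div_iff₀ (by positivity) (by positivity)]
    have : (v : ℝ) ≤ 3 * s := by exact_mod_cast hv3
    nlinarith
  have f2 : (6 : ℝ) ^ v ≤ 216 ^ s := by
    calc (6 : ℝ) ^ v ≤ 6 ^ (3 * s) := pow_le_pow_right₀ (by norm_num) hv3
      _ = 216 ^ s := by rw [pow_mul]; norm_num
  have f3 : ((v : ℝ) / N) ^ q ≤ (1 / L) ^ s := by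
    have h1 : (v : ℝ) / N ≤ 1 / L ^ 8 := by
      rw [div_le_div_iff₀ hNR (by positivity)]
      have : (3 * L ^ 8 * s : ℝ) ≤ N := by exact_mod_cast hN
      have : (v : ℝ) ≤ 3 * s := by exact_mod_cast hv3
      nlinarith
    calc ((v : ℝ) / N) ^ q ≤ (1 / L ^ 8) ^ q := pow_le_pow_left₀ (by positivity) h1 _
      _ = (1 / L) ^ (8 * q) := by rw [div_pow, div_pow, one_pow, one_pow, ← pow_mul]
      _ ≤ (1 / L) ^ s := pow_le_pow_of_le_one (by positivity) (by
          rw [div_le_one (by positivity)]; exact hLR) hqs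
  have hprod : (3 * K * v / (4 * s) : ℝ) ^ s * 6 ^ v * ((v : ℝ) / N) ^ q ≤
      (9 * K / 4) ^ s * 216 ^ s * (1 / L) ^ s :=
    mul_le_mul (mul_le_mul f1 f2 (by positivity) (by positivity)) f3 (by positivity) (by positivity)
  refine hprod.trans ?_
  rw [← mul_pow, ← mul_pow]
  refine pow_le_pow_left₀ (by positivity) ?_ _
  -- 9K/4 · 216 · (1/L) = 486 K / L ≤ 1/4
  have : (1944 * K : ℝ) ≤ L := by exact_mod_cast hL
  rw [show (9 * K / 4 * 216 * (1 / L) : ℝ) = 486 * K / L by field_simp; ring,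
    div_le_div_iff₀ (by positivity) (by norm_num)]
  linarith

/-- The finite geometric sum `Σ_{i<r} (1/4)^{i+1} = (1 − (1/4)^r)/3 < 1/2`. -/
theorem geom_quarter_lt_half (r : ℕ) : ∑ i ∈ Finset.range r, (1 / 4 : ℝ) ^ (i + 1) < 1 / 2 := by
  have h : ∑ i ∈ Finset.range r, (1 / 4 : ℝ) ^ (i + 1) = (1 - (1 / 4) ^ r) / 3 := by
    induction r with
    | zero => simp
    | succ r ih => rw [Finset.sum_range_succ, ih]; ring
  rw [h]
  have : (0 : ℝ) < (1 / 4) ^ r := by positivity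
  linarith

/-! ## Most outcomes are good -/

/-- **Most outcomes are good (ratio `7/4`).**  With `L ≥ 1944K`, `N ≥ 2`, `m ≤ KN` and `r = N/(3L⁸)`, fewer than HALF of the
outcomes are `bad74` (the other half of the probability budget goes to the simple-overlap alteration). -/
theorem two_mul_card_badSet74_lt (K L N m : ℕ) (hL : 1944 * K ≤ L) (hL1 : 1 ≤ L) (hN : 2 ≤ N) (hm : m ≤ K * N) :
    2 * ((badSet74 N m (N / (3 * L ^ 8))).card : ℝ) < (Fintype.card (Outcome N m) : ℝ) := by
  set r := N / (3 * L ^ 8) with hr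
  have hL4 : 1 ≤ L ^ 8 := Nat.one_le_pow _ _ hL1
  have hr3 : 3 * r ≤ N := by
    have := Nat.div_mul_le_self N (3 * L ^ 8)
    nlinarith
  -- the number of outcomes
  set Q : ℕ := Fintype.card (DPair N × DPair N) with hQ
  have hcardΩ : Fintype.card (Outcome N m) = Q ^ m := by
    rw [Fintype.card_fun, Fintype.card_fin]
  have hD : Fintype.card (DPair N) = N * N - N := by
    unfold DPair
    rw [Fintype.card_subtype_compl, Fintype.card_prod, Fintype.card_fin]
    congr 1
    -- pairs with equal coordinates ↔ the diagonal
    rw [Fintype.card_subtype]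
    have : (univ.filter fun p : Fin N × Fin N => p.1 = p.2) = (univ : Finset (Fin N)).image fun a => (a, a) := by
      ext p
      simp only [Finset.mem_filter, Finset.mem_univ, true_and, Finset.mem_image]
      constructor
      · intro h; exact ⟨p.1, by rw [Prod.ext_iff]; exact ⟨rfl, h⟩⟩
      · rintro ⟨a, rfl⟩; rfl
    rw [this, Finset.card_image_of_injective _ (fun a b h => (Prod.ext_iff.1 h).1), Finset.card_univ,
      Fintype.card_fin]
  have hQpos : (0 : ℝ) < Q := by
    have : 0 < Q := by
      rw [hQ, Fintype.card_prod, hD]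
      have : 2 ≤ N * N - N := by
        have : N + 2 ≤ N * N := by nlinarith
        omega
      positivity
    exact_mod_cast this
  have hQge : (4 : ℝ) * (N : ℝ) ^ 4 ≤ 16 * Q := by
    have h1 : (Q : ℝ) = ((N * N - N : ℕ) : ℝ) ^ 2 := by
      rw [hQ, Fintype.card_prod, hD]; push_cast; ring
    have h2 : ((N * N - N : ℕ) : ℝ) = (N : ℝ) * N - N := by
      rw [Nat.cast_sub (Nat.le_mul_self N)]; push_cast; ring
    rw [h1, h2]
    have hN2 : (2 : ℝ) ≤ N := by exact_mod_cast hN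
    nlinarith [sq_nonneg ((N : ℝ) * N - 2 * N), mul_nonneg (sub_nonneg.2 hN2) (sq_nonneg (N : ℝ))]
  -- the union bound, term by term
  have hub := card_badSet74_le (m := m) r hr3
  refine lt_of_le_of_lt (mul_le_mul_of_nonneg_left hub (by norm_num)) ?_
  rw [hcardΩ]
  push_cast
  have hterm : ∀ i ∈ Finset.range r,
      (m.choose (i + 1) : ℝ) * ((N + N).choose (v74 (i + 1)) : ℝ) * (((v74 (i + 1) : ℕ) : ℝ) ^ 4 / 16) ^ (i + 1) *
          (Q : ℝ) ^ (m - (i + 1)) ≤ (1 / 4) ^ (i + 1) * (Q : ℝ) ^ m := by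
    intro i hi
    rw [Finset.mem_range] at hi
    have hs : 3 * L ^ 8 * (i + 1) ≤ N := by
      have : i + 1 ≤ r := hi
      have := Nat.div_mul_le_self N (3 * L ^ 8)
      calc 3 * L ^ 8 * (i + 1) ≤ 3 * L ^ 8 * r := Nat.mul_le_mul_left _ hi
        _ ≤ N := by rw [hr, Nat.mul_comm]; exact Nat.div_mul_le_self N (3 * L ^ 8)
    have hsm : i + 1 ≤ m ∨ m < i + 1 := le_or_gt _ _
    have ht := term74_le K L N (i + 1) m (by omega) hL hL1 hs hm
    -- compare (v⁴/16)^s Q^{m-s} with (v⁴/(4N⁴))^s Q^m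
    rcases hsm with hsm | hsm
    · have hQsplit : (Q : ℝ) ^ m = (Q : ℝ) ^ (i + 1) * (Q : ℝ) ^ (m - (i + 1)) := by
        rw [← pow_add]; congr 1; omega
      rw [hQsplit]
      have hstep : (((v74 (i + 1) : ℕ) : ℝ) ^ 4 / 16) ^ (i + 1) ≤
          (((v74 (i + 1) : ℕ) : ℝ) ^ 4 / (4 * (N : ℝ) ^ 4)) ^ (i + 1) * (Q : ℝ) ^ (i + 1) := by
        rw [← mul_pow]
        refine pow_le_pow_left₀ (by positivity) ?_ _
        rw [div_mul_eq_mul_div, div_le_div_iff₀ (by norm_num) (by positivity)]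
        have h0 : (0 : ℝ) ≤ ((v74 (i + 1) : ℕ) : ℝ) ^ 4 := by positivity
        nlinarith
      have hQm : (0 : ℝ) ≤ (Q : ℝ) ^ (m - (i + 1)) := by positivity
      have hcc : (0 : ℝ) ≤ (m.choose (i + 1) : ℝ) * ((N + N).choose (v74 (i + 1)) : ℝ) := by positivity
      calc (m.choose (i + 1) : ℝ) * ((N + N).choose (v74 (i + 1)) : ℝ) *
            (((v74 (i + 1) : ℕ) : ℝ) ^ 4 / 16) ^ (i + 1) * (Q : ℝ) ^ (m - (i + 1))
          ≤ (m.choose (i + 1) : ℝ) * ((N + N).choose (v74 (i + 1)) : ℝ) *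
            ((((v74 (i + 1) : ℕ) : ℝ) ^ 4 / (4 * (N : ℝ) ^ 4)) ^ (i + 1) * (Q : ℝ) ^ (i + 1)) *
              (Q : ℝ) ^ (m - (i + 1)) := by
            exact mul_le_mul_of_nonneg_right (mul_le_mul_of_nonneg_left hstep hcc) hQm
        _ = ((m.choose (i + 1) : ℝ) * ((N + N).choose (v74 (i + 1)) : ℝ) *
            (((v74 (i + 1) : ℕ) : ℝ) ^ 4 / (4 * (N : ℝ) ^ 4)) ^ (i + 1)) *
              ((Q : ℝ) ^ (i + 1) * (Q : ℝ) ^ (m - (i + 1))) := by ring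
        _ ≤ (1 / 4) ^ (i + 1) * ((Q : ℝ) ^ (i + 1) * (Q : ℝ) ^ (m - (i + 1))) :=
            mul_le_mul_of_nonneg_right ht (by positivity)
    · -- `m < s`: the binomial `C(m, s)` vanishes
      rw [Nat.choose_eq_zero_of_lt hsm]
      simp only [Nat.cast_zero, zero_mul]
      positivity
  have hsum := Finset.sum_le_sum hterm
  rw [← Finset.sum_mul] at hsum
  have hQm : (0 : ℝ) < (Q : ℝ) ^ m := by positivity
  have hg := geom_quarter_lt_half r
  nlinarith

/-- **An outcome good on both counts exists** (`L ≥ 1944K`, `N ≥ 2`, `m ≤ KN`): not `bad74` at radius `N/(3L⁸)` and with at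
most `80K²` output pairs sharing two variables — the two failure sets each have fewer than / at most half of the outcomes of the
one space `Outcome N m`. -/
theorem exists_good74 (K L N m : ℕ) (hL : 1944 * K ≤ L) (hL1 : 1 ≤ L) (hN : 2 ≤ N) (hm : m ≤ K * N) :
    ∃ ω : Outcome N m, ¬bad74 (N / (3 * L ^ 8)) ω ∧ (ovl ω).card ≤ 80 * K ^ 2 := by
  classical
  set B := badSet74 N m (N / (3 * L ^ 8)) with hB
  set M := univ.filter fun ω : Outcome N m => 80 * K ^ 2 < (ovl ω).card with hM
  have h1 : 2 * B.card < Fintype.card (Outcome N m) := by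
    have := two_mul_card_badSet74_lt K L N m hL hL1 hN hm
    exact_mod_cast this
  have h2 : 2 * M.card ≤ Fintype.card (Outcome N m) := two_mul_card_many_le K hN hm
  have h3 : (B ∪ M).card < Fintype.card (Outcome N m) := by
    have := card_union_le B M
    omega
  obtain ⟨ω, -, hω⟩ := exists_mem_notMem_of_card_lt_card (s := B ∪ M) (t := (univ : Finset (Outcome N m)))
    (by rw [card_univ]; exact h3)
  rw [mem_union, not_or] at hω
  refine ⟨ω, fun hb => hω.1 ?_, ?_⟩
  · rw [hB]
    unfold PstarExpanding74Count.badSet74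
    exact mem_filter.2 ⟨mem_univ _, hb⟩
  · by_contra hlt
    push Not at hlt
    exact hω.2 (mem_filter.2 ⟨mem_univ _, hlt⟩)

end Summit.PneNP.PneNP.Theorems.PstarExpanding74Exist
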